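import Mathlib

/-!
# SoloBlindSubobjectChain — subobject lifting along a whole weight chain (PROP W (ii) ⟹ (i), m-fold)

Solo-blind programme on `Summit.KontsevichZagierPeriods` (Kontsevich–Zagier period conjecture in the
effective Nori form), session s76.  Kernel form of the FULL INDUCTION of PROPOSITION W (ii) ⟹ (i)
(`paper/inj-sectors.md` §12, claim C670; prose re-verified s70/s71): over a Hodge-conjecture sector,
if the PURE graded pieces satisfy effective fullness ("Inj", THEOREM Inj_𝒮) and every effective
subquotient satisfies SPLITTING DESCENT for its lowest weight (D) — with complements unique by the
strictness of weights (U), `SoloBlindComplementUnique` — then EVERY subobject downstairs of the mixed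
object is effective: Inj holds for the mixed object.  Companion of `SoloBlindSplittingChain`
((iii) ⟹ (ii) m-fold) and of `SoloBlindSplittingDevissage` (s71).

The shadow (as in those files).  `Φ : MM^eff → MM` = restriction of scalars along an algebra `A → B`
on a `B`-module `E`; effective subobjects = `B`-submodules, subobjects downstairs = `A`-submodules;
the weight filtration is a chain of `B`-submodules `W 0 ≤ W 1 ≤ ⋯ ≤ W (m+1) = ⊤`; the quotient
`E ⧸ W j` is the interval above `W j`, so "a subobject of `Φ(E ⧸ W j)`" is an `A`-submodule
`N ≥ W j`, and its lowest-weight part and its image modulo the lowest piece are `N ⊓ W (j+1)` and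
`N ⊔ W (j+1)`.

`forall_exists_restrictScalars_eq_of_chain`: hypotheses, for every `j ≤ m`:
(G) every `A`-submodule `N` with `W j ≤ N ≤ W (j+1)` is effective (Inj for the pure piece
`gr_{j+1} = W (j+1) ⧸ W j`); and for all `B`-submodules `P`, `T` with `W j ≤ P ≤ W (j+1) ≤ T`
(so `T ⧸ P` is an effective subquotient with lowest-weight part `W (j+1) ⧸ P`):
(U) `A`-complements of `W (j+1)` over `P` inside `T` are unique (torsor under
`Hom(T ⧸ W (j+1), W (j+1) ⧸ P) = 0`, weights); (D) such an `A`-complement descends to a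
`B`-complement.  Conclusion: every `A`-submodule `N ≥ W 0` is `P.restrictScalars A` for some
`B`-submodule `P` (for `W 0 = ⊥`: every subobject downstairs is effective).  Proof = the induction
of PROP W run downward along the chain: `N ⊓ W (j+1)` is effective by (G), `N ⊔ W (j+1)` by the
induction hypothesis, and `N` is an `A`-complement of `W (j+1)` over the former inside the latter,
hence effective by (D) + (U).  No modular law is needed at this level; complete proof, standard
axioms only.
-/

namespace Summit.KontsevichZagierPeriods.KontsevichZagierPeriods.Theorems

open Submodule

universe u v w

variable {A : Type u} {B : Type v} {E : Type w} [CommRing A] [Ring B] [Algebra A B]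
  [AddCommGroup E] [Module A E] [Module B E] [IsScalarTower A B E]

/-- **Subobject lifting along a weight chain (PROP W (ii) ⟹ (i), m-fold).**  For a chain of
`B`-submodules `W 0 ≤ W 1 ≤ ⋯ ≤ W (m+1) = ⊤`: graded effective fullness (G), uniqueness of
complements of the lowest piece in effective subquotients (U) and splitting descent for them (D)
imply that every `A`-submodule `N ≥ W 0` of `E` is the restriction of scalars of a `B`-submodule. -/
theorem forall_exists_restrictScalars_eq_of_chain (W : ℕ → Submodule B E)
    (hW : ∀ j, W j ≤ W (j + 1)) (m : ℕ) (htop : W (m + 1) = ⊤)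
    (hG : ∀ j, j ≤ m → ∀ N : Submodule A E, (W j).restrictScalars A ≤ N →
      N ≤ (W (j + 1)).restrictScalars A → ∃ P : Submodule B E, P.restrictScalars A = N)
    (huniq : ∀ j, j ≤ m → ∀ P T : Submodule B E, W j ≤ P → P ≤ W (j + 1) → W (j + 1) ≤ T →
      ∀ N N' : Submodule A E,
      P.restrictScalars A ≤ N → N ⊓ (W (j + 1)).restrictScalars A = P.restrictScalars A →
        N ⊔ (W (j + 1)).restrictScalars A = T.restrictScalars A →
      P.restrictScalars A ≤ N' → N' ⊓ (W (j + 1)).restrictScalars A = P.restrictScalars A →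
        N' ⊔ (W (j + 1)).restrictScalars A = T.restrictScalars A → N = N')
    (hD : ∀ j, j ≤ m → ∀ P T : Submodule B E, W j ≤ P → P ≤ W (j + 1) → W (j + 1) ≤ T →
      (∃ N : Submodule A E, P.restrictScalars A ≤ N ∧
        N ⊓ (W (j + 1)).restrictScalars A = P.restrictScalars A ∧
          N ⊔ (W (j + 1)).restrictScalars A = T.restrictScalars A) →
      ∃ R : Submodule B E, P ≤ R ∧ R ⊓ W (j + 1) = P ∧ R ⊔ W (j + 1) = T)
    (N : Submodule A E) (hN0 : (W 0).restrictScalars A ≤ N) :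
    ∃ P : Submodule B E, P.restrictScalars A = N := by
  -- Ψ j : every A-submodule containing W j is effective; downward induction on j,
  -- packaged as an induction on k with j + k = m + 1.
  have key : ∀ k j : ℕ, j + k = m + 1 → ∀ N : Submodule A E, (W j).restrictScalars A ≤ N →
      ∃ P : Submodule B E, P.restrictScalars A = N := by
    intro k
    induction k with
    | zero =>
      intro j hj N hN
      have hjm : j = m + 1 := by simpa using hj
      rw [hjm, htop, restrictScalars_top, top_le_iff] at hN
      exact ⟨⊤, by rw [hN, restrictScalars_top]⟩
    | succ k ih =>
      intro j hj N hN
      have hjm : j ≤ m := by omega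
      have hj1 : (j + 1) + k = m + 1 := by omega
      have hWj' : (W j).restrictScalars A ≤ (W (j + 1)).restrictScalars A :=
        (restrictScalars_le A).2 (hW j)
      -- The lowest-weight part N ⊓ W (j+1) is effective by graded fullness (G).
      obtain ⟨P, hP⟩ :=
        hG j hjm (N ⊓ (W (j + 1)).restrictScalars A) (le_inf hN hWj') inf_le_right
      -- The image modulo the lowest piece, N ⊔ W (j+1), is effective by induction.
      obtain ⟨T, hT⟩ := ih (j + 1) hj1 (N ⊔ (W (j + 1)).restrictScalars A) le_sup_right
      have hPN : P.restrictScalars A ≤ N := by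
        rw [hP]
        exact inf_le_left
      have hjP : W j ≤ P := (restrictScalars_le A).1 (by rw [hP]; exact le_inf hN hWj')
      have hP1 : P ≤ W (j + 1) := (restrictScalars_le A).1 (by rw [hP]; exact inf_le_right)
      have h1T : W (j + 1) ≤ T := (restrictScalars_le A).1 (by rw [hT]; exact le_sup_right)
      -- N is an A-complement of W (j+1) over P inside T: descent (D) gives an effective one,
      -- uniqueness (U) identifies it with N.
      obtain ⟨R, hPR, hRinf, hRsup⟩ := hD j hjm P T hjP hP1 h1T ⟨N, hPN, hP.symm, hT.symm⟩
      refine ⟨R, huniq j hjm P T hjP hP1 h1T _ _ ((restrictScalars_le A).2 hPR) ?_ ?_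
        hPN hP.symm hT.symm⟩
      · rw [← restrictScalars_inf, hRinf]
      · rw [← restrictScalars_sup, hRsup]
  exact key (m + 1) 0 (by simp) N hN0

/-- Absolute form (`W 0 = ⊥`): under (G), (U), (D) along the chain, EVERY `A`-submodule of `E` is
effective — Inj for the mixed object `E` (PROP W (ii) ⟹ (i)). -/
theorem forall_exists_restrictScalars_eq_of_chain_bot (W : ℕ → Submodule B E)
    (hW : ∀ j, W j ≤ W (j + 1)) (h0 : W 0 = ⊥) (m : ℕ) (htop : W (m + 1) = ⊤)
    (hG : ∀ j, j ≤ m → ∀ N : Submodule A E, (W j).restrictScalars A ≤ N →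
      N ≤ (W (j + 1)).restrictScalars A → ∃ P : Submodule B E, P.restrictScalars A = N)
    (huniq : ∀ j, j ≤ m → ∀ P T : Submodule B E, W j ≤ P → P ≤ W (j + 1) → W (j + 1) ≤ T →
      ∀ N N' : Submodule A E,
      P.restrictScalars A ≤ N → N ⊓ (W (j + 1)).restrictScalars A = P.restrictScalars A →
        N ⊔ (W (j + 1)).restrictScalars A = T.restrictScalars A →
      P.restrictScalars A ≤ N' → N' ⊓ (W (j + 1)).restrictScalars A = P.restrictScalars A →
        N' ⊔ (W (j + 1)).restrictScalars A = T.restrictScalars A → N = N')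
    (hD : ∀ j, j ≤ m → ∀ P T : Submodule B E, W j ≤ P → P ≤ W (j + 1) → W (j + 1) ≤ T →
      (∃ N : Submodule A E, P.restrictScalars A ≤ N ∧
        N ⊓ (W (j + 1)).restrictScalars A = P.restrictScalars A ∧
          N ⊔ (W (j + 1)).restrictScalars A = T.restrictScalars A) →
      ∃ R : Submodule B E, P ≤ R ∧ R ⊓ W (j + 1) = P ∧ R ⊔ W (j + 1) = T)
    (N : Submodule A E) : ∃ P : Submodule B E, P.restrictScalars A = N :=
  forall_exists_restrictScalars_eq_of_chain W hW m htop hG huniq hD N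
    (by rw [h0, restrictScalars_bot]; exact bot_le)

end Summit.KontsevichZagierPeriods.KontsevichZagierPeriods.Theorems
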